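import Summits.NavierStokesRegularity.NavierStokesRegularity.Theorems.FrequencyRigidity.Negative.RigidRotation

/-!
# `FrequencyRigidity` (crux `stmt-NavierStokesRegularity-2955`): (B′) the local-Type-I variant
# fails with an arbitrarily SMALL constant — slow rigid rotation — negative-side support, file 5

Companion of `Negative/RigidRotation.lean` ((B): the crux with the Type-I bound localised to the
unit backward parabolic cylinder `Q₁(0,0)` is false, by rigid rotation `e₃ × x`, `C = 1`).
Here: for every `C > 0` the slow rotation `v = Ω e₃ × x`, `|Ω| = C`, `q = ½‖v‖²`, `K` = backward
heat kernel, `Λ₀ = 0`, `H ≡ 4Ω²`, is a witness with LOCAL Type-I constant `C`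
(`frequencyRigidity_false_with_local_typeI_small`, via `isClassicalNSSolutionOn_skew` for any
skew-adjoint linear field and `curl_smul_rot`).  Contrast: the GLOBAL crux is TRUE for small `C`
(for a bounded mild ancient `w`, `M = sup √(−t)‖w(t)‖∞` obeys `M ≤ κ ν^{−1/2} M²` by Duhamel from
`t₀ → −∞`, so `M = 0` below the gap; KNSS arXiv:0709.3599 §3 for `bounded = mild + b(t)`), so the
distinction global/local in the Type-I hypothesis is substantive, not a normalisation.

## References

* G. Koch, N. Nadirashvili, G. Seregin, V. Šverák, Acta Math. 203 (2009) 83–105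
  (arXiv:0709.3599, §3 Lemma 3.1 and p. 3). [KochNadirashviliSereginSverak2009]
* T.-P. Tsai, Arch. Ration. Mech. Anal. 143 (1998) 29–51, Thm 1 (`q ∈ (3,∞]`), Remark 5.4. [Tsai1998]
-/

noncomputable section

set_option linter.dupNamespace false

namespace Summit.NavierStokesRegularity.NavierStokesRegularity.Theorems.FrequencyRigidity.Negative

open Literature.Analysis.FluidPDE Literature.Analysis.UnboundedOperators
open MeasureTheory Set Filter Topology Function
open scoped Laplacian InnerProductSpace RealInnerProductSpace ContDiff

/-! ### (B′) … even with an arbitrarily SMALL local Type-I constant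

Contrast: the GLOBAL statement is TRUE for small `C` (gap argument in the module docstring), but
the LOCAL one is false for every `C = |Ω| > 0`: slow rigid rotation `v = Ω e₃ × x`. -/

/-- Every skew-adjoint linear field `v = A x` with pressure `q = ½‖A x‖²` is a smooth steady
classical NS flow on any time set (`(v·∇)v = A(Ax) = −∇q`, `Δv = 0`, `div v = tr A = 0`). -/
theorem isClassicalNSSolutionOn_skew (A : E3 →L[ℝ] E3) (hA : ∀ x y : E3, ⟪A x, y⟫ = -⟪x, A y⟫)
    (S : Set ℝ) (ν : ℝ) :
    IsClassicalNSSolutionOn S ν 0 (fun _ x => A x) (fun _ x => 2⁻¹ * ‖A x‖ ^ 2) where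
  smooth_velocity := (A.contDiff.comp contDiff_snd).contDiffOn
  smooth_pressure := ((contDiff_const.mul (A.contDiff.norm_sq ℝ)).comp contDiff_snd).contDiffOn
  momentum t ht x := by
    have hsq : HasFDerivAt (fun y : E3 => 2⁻¹ * ‖A y‖ ^ 2)
        ((2⁻¹ : ℝ) • ((2 • innerSL ℝ (A x)).comp A)) x :=
      (((hasStrictFDerivAt_norm_sq (A x)).hasFDerivAt.comp x A.hasFDerivAt).const_mul 2⁻¹)
    have hP : HasFDerivAt (fun y : E3 => 2⁻¹ * ‖A y‖ ^ 2)
        (InnerProductSpace.toDual ℝ E3 (-(A (A x)))) x := by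
      refine hsq.congr_fderiv (ContinuousLinearMap.ext fun h => ?_)
      simp only [_root_.smul_apply, ContinuousLinearMap.comp_apply,
        innerSL_apply_apply, InnerProductSpace.toDual_apply_apply, inner_neg_left, smul_eq_mul,
        nsmul_eq_mul, Nat.cast_ofNat]
      rw [hA (A x) h]
      ring
    have hgrad : gradient (fun y : E3 => 2⁻¹ * ‖A y‖ ^ 2) x = -(A (A x)) :=
      (hasGradientAt_iff_hasFDerivAt.mpr hP).gradient
    have hΔ : (Δ (fun y : E3 => A y)) x = 0 := laplacian_clm A x
    have hconv : convect (fun y : E3 => A y) (fun y : E3 => A y) x = A (A x) := by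
      rw [convect_apply, show (fun y : E3 => A y) = ⇑A from rfl, ContinuousLinearMap.fderiv]
    simp only [timeDerivWithin_apply, derivWithin_fun_const, Pi.zero_apply, zero_add, add_zero,
      smul_zero, zero_sub, hconv, hΔ, hgrad, neg_neg]
  divFree t ht x := by
    show VectorCalculus.divergence (⇑A) x = 0
    rw [divergence_eq_sum_inner_fderiv (stdOrthonormalBasis ℝ E3)]
    refine Finset.sum_eq_zero fun i _ => ?_
    rw [ContinuousLinearMap.fderiv]
    have h1 := hA (stdOrthonormalBasis ℝ E3 i) (stdOrthonormalBasis ℝ E3 i)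
    rw [real_inner_comm] at h1
    linarith

/-- `Ω • rot` is skew-adjoint. -/
theorem smul_rot_skew (Ω : ℝ) (x y : E3) : ⟪(Ω • rot) x, y⟫ = -⟪x, (Ω • rot) y⟫ := by
  show ⟪Ω • rot x, y⟫ = -⟪x, Ω • rot y⟫
  rw [inner_smul_left, inner_smul_right, rot_skew, conj_trivial]
  ring

/-- Vorticity of slow rigid rotation: `curl (Ω e₃ × ·) = 2Ω e₃`. -/
theorem curl_smul_rot (Ω : ℝ) (x : E3) : curl (⇑(Ω • rot)) x = (2 * Ω) • e₃ := by
  simp only [curl, ContinuousLinearMap.fderiv]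
  ext i
  fin_cases i <;> (simp [rot_apply, cross, cross_apply, e₃]; try ring)

/-- **(B′)** For every `Ω ≠ 0` the slow rigid rotation `v = Ω e₃ × x` (local Type-I constant
`C = |Ω|` on `Q₁(0,0)`, as small as desired), `q = ½‖Ω e₃ × x‖²`, `K` = heat kernel, `Λ₀ = 0`,
`H ≡ 4Ω²`, witnesses the failure of the LOCAL-Type-I variant.  So smallness of a local Type-I
constant buys nothing, while the GLOBAL crux is true for small `C` (gap). -/
theorem localTypeI_witness_small {Ω : ℝ} (hΩ : Ω ≠ 0) :
    ∃ (v : ℝ → E3 → E3) (q : ℝ → E3 → ℝ) (K : ℝ → E3 → ℝ),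
      IsClassicalNSSolutionOn (Iio 0) 1 0 v q ∧ LocalTypeIBound |Ω| v ∧ KernelClauses 1 v K ∧
      Comparable K ∧ FreqClause v K 0 := by
  refine ⟨fun _ x => (Ω • rot) x, fun _ x => 2⁻¹ * ‖(Ω • rot) x‖ ^ 2, backwardHeatKernel 1 0 (0:E3),
    isClassicalNSSolutionOn_skew _ (smul_rot_skew Ω) _ _, ?_, ?_, comparable_backwardHeatKernel one_pos,
    ?_⟩
  · intro t ht x hx
    have hst : 0 < Real.sqrt (-t) := Real.sqrt_pos.2 (by linarith [ht.2])
    have hs1 : Real.sqrt (-t) ≤ 1 := Real.sqrt_le_one.mpr (by linarith [ht.1])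
    show ‖Ω • rot x‖ ≤ |Ω| / Real.sqrt (-t)
    rw [le_div_iff₀ hst, norm_smul, Real.norm_eq_abs]
    calc |Ω| * ‖rot x‖ * Real.sqrt (-t) ≤ |Ω| * ‖x‖ * 1 :=
          mul_le_mul (mul_le_mul_of_nonneg_left (norm_rot_le x) (abs_nonneg _)) hs1 hst.le
            (mul_nonneg (abs_nonneg _) (norm_nonneg _))
      _ ≤ |Ω| := by nlinarith [abs_nonneg Ω]
  · refine kernelClauses_backwardHeatKernel one_pos _ (fun t _ x => ?_)
    show ⟪x, Ω • rot x⟫ = 0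
    rw [inner_smul_right, inner_self_rot, mul_zero]
  · intro H Λ hH hΛ
    have hH4 : ∀ t ∈ Iio (0:ℝ), H t = 4 * Ω ^ 2 := fun t ht => by
      rw [hH]
      have h1 : ∀ x, ‖curl ((fun (_ : ℝ) (x : E3) => (Ω • rot) x) t) x‖ ^ 2 = 4 * Ω ^ 2 :=
        fun x => by
          show ‖curl (⇑(Ω • rot)) x‖ ^ 2 = 4 * Ω ^ 2
          rw [curl_smul_rot, norm_smul, e₃, PiLp.norm_single, Real.norm_eq_abs]
          simp only [norm_one, mul_one]
          rw [sq_abs]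
          ring
      simp_rw [h1, integral_const_mul, integral_backwardHeatKernel one_pos (0:E3) ht, mul_one]
    refine ⟨fun t ht => by rw [hH4 t ht]; positivity, fun t ht => ?_⟩
    have hev : H =ᶠ[𝓝 t] fun _ => (4 * Ω ^ 2 : ℝ) :=
      Filter.eventuallyEq_of_mem (Iio_mem_nhds ht) fun s hs => hH4 s hs
    rw [hΛ]
    simp only [hev.deriv_eq, deriv_const, mul_zero, zero_div]

/-- (B′) packaged: the local-Type-I variant fails with every prescribed constant `C > 0`. -/
theorem frequencyRigidity_false_with_local_typeI_small {C : ℝ} (hC : 0 < C) :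
    ∃ (ν Λ₀ : ℝ) (v : ℝ → E3 → E3) (q : ℝ → E3 → ℝ) (K : ℝ → E3 → ℝ), 0 < ν ∧
      IsClassicalNSSolutionOn (Iio 0) ν 0 v q ∧ LocalTypeIBound C v ∧ KernelClauses ν v K ∧
      Comparable K ∧ FreqClause v K Λ₀ := by
  obtain ⟨v, q, K, h1, h2, h3, h4, h5⟩ := localTypeI_witness_small hC.ne'
  exact ⟨1, 0, v, q, K, one_pos, h1, by rwa [abs_of_pos hC] at h2, h3, h4, h5⟩

end Summit.NavierStokesRegularity.NavierStokesRegularity.Theorems.FrequencyRigidity.Negative
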